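import Literature.NumberTheory.GaloisCohomology.Howard2004.FiniteSingularEvaluation
import Literature.NumberTheory.Automorphic.AdicCompletionResidueCard
import HarnessLib

/-!
# Howard 2004, Def. 1.1.8 / Def. 1.2.3: the finite–singular comparison map, CONSTRUCTED (tame pin),
# natural in the module and bijective on `H¹_f` — an inhabitant of `LevelData.IsFsAdmissible`

Topic `NumberTheory/GaloisCohomology/Howard2004` (sequel to `FiniteSingularNatural` (the pin as a
predicate) and `FiniteSingularEvaluation` (Prop. 1.1.7 in the kernel); cell `pub/bsd-print-x9`, lit
g32, obligation (n1) of x9-p1 LEAD g3's ruling 2026-08-28T15:36:26Z).  DEFINITIONS WITH BODIES +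
THEOREMS ONLY (no named fact, no instance, no `sorry`).

Howard, Def. 1.1.8 [arXiv:1202.6340 p. 5, L144–149]: «we define the finite-singular comparison map
to be the isomorphism `φ^{fs}_v : H¹_f(K_v,T) ≅ T ≅ H¹_s(K_v,T) ⊗ k_vˣ` given by Proposition
1.1.7», and Def. 1.2.3 [p. 6, L126–131]: «For any `nℓ ∈ 𝓝₀`, we may identify the `p`-Sylow
subgroups of `G_ℓ` and `k_λˣ/k_ℓˣ` via the Artin symbol, and let
`φ^{fs}_ℓ : H¹_f(K_ℓ, T/I_{nℓ}T) ≅ H¹_s(K_ℓ, T/I_{nℓ}T) ⊗ G_ℓ` be the finite-singular comparison map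
at `ℓ`» (`G_ℓ = k_λˣ/k_ℓˣ`, Def. 1.2.1).

THE CONSTRUCTION.  At a finite place `v` of the number field `K`, for a discrete `Γ_{K_v}`-module
`N` with TRIVIAL action, finite, with `(q_v − 1)·N = 0` (Howard's «`|k_vˣ|·T = 0`»), and a
**tame pin** `π : TamePin v` — a tame generator `σ₀ ∈ I_{K_v}` (`IsTameGenerator`: the tame character
of level `q_v − 1` takes a primitive root of unity at `σ₀`), an arithmetic Frobenius lift `φ`
(`IsFrobPow φ 1`) and a generator `g` of `k_vˣ` — the map
  `TamePin.fs π ρ : H¹(K_v, N) →+ H¹_s(K_v, N) ⊗ G_v`,  `c ↦ (singularEval σ₀)⁻¹(c(φ)) ⊗ ḡ`,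
i.e. «`H¹_f ≅ T`» by evaluation at the Frobenius (`evalClass_bijective_unramified`), «`T ≅ H¹_s ⊗ k_vˣ`»
by the inverse of `c ⊗ g ↦ c(σ_g)` at the generator (`singularEval_bijective`), followed by
`k_vˣ ↠ G_v = k_vˣ/k_ℓˣ` on the second factor (`g ↦ ḡ`).  This is Def. 1.1.8 / 1.2.3 in Kim's
generator-fixed reading (tree precedent `IsFiniteSingularComparisonWith … φ τ` of
`GaloisCohomology/FiniteSingularComparison`), with the inertia element `σ_g` matched to `g` through
the TAME CHARACTER `I_{K_v} ↠ k_vˣ` (Serre 1972 §1.3); Howard matches them through the Artin symbol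
on units, which replaces `g` by `g^{±1}` (Serre, *Local Fields* XIV §3) — a unit `±1 ∈ R'ˣ`
uniformly in `(n, ℓ)`, transported on Kolyvagin systems by `κ_n ↦ (±1)^{|n|} κ_n`
(`FiniteSingularNatural`, reading note (v); the rescaling is the cell's (n2), x9-p1-w2).  HONEST
LABEL: a different pin `π` changes `fs` by units of `R' = End`-scalars at each `(n, ℓ)`; every pin
gives an ADMISSIBLE slot, which is what `SatisfiesH.fs_admissible` / `CoeffTowerSetting.FsAdmissible`
consume.

* §1 `tmulRight_bijective` — `a ↦ a ⊗ γ : A → A ⊗_ℤ G` is bijective for `G` finite cyclic generated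
  by `γ` and `#G · A = 0` (the passage `k_vˣ ↠ G_v` on the second tensor factor; pure algebra).
* §2 `TamePin v` (+ `nonempty_tamePin`), `TamePin.gbar`, **`TamePin.fs`**, `TamePin.fs_apply`,
  `fs_oneCocycleClass_of_apply_eq` (the value on a class is determined by `c(φ)`: if `z(σ₀) = w(φ)`
  then `fs [w] = loc^s[z] ⊗ ḡ`).
* §3 **`TamePin.fs_natural`** — for global modules `ρ, ρ'` and a locally equivariant additive
  `g : N → N'`: `fs' (H¹(g) c) = (H¹_s(g) ⊗ 1)(fs c)` for ALL `c` (both factors are evaluations of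
  cocycles, which commute with `g`) — the shape of `LevelData.FsNaturalAt`.
* §4 **`TamePin.fs_bijective_unramified`** — `fs` restricted to `H¹_ur(K_v, N)` is a bijection onto
  `H¹_s(K_v, N) ⊗ G_v` when moreover `#G_v · N = 0` (at a degree-two `v`: `#G_v = ℓ + 1`,
  `natCard_gell_of_isDegreeTwo`; Howard: `ℓ + 1 ∈ I_ℓ ⊆ I_n` kills `T/I_nT`) — the shape of
  `LevelData.FsBijectiveAt`.
* §5 `tameSlot` (a TOTAL slot: `TamePin.fs` where the hypotheses hold, `0` elsewhere) and
  **`LevelData.isFsAdmissible_of_fs_eq_tameSlot`** — a `LevelData` whose `fs` is the tame slot IS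
  `IsFsAdmissible`, given, at every `λ ∈ n ∈ 𝓝(𝓛)`: trivial local action on `T/I_nT`,
  `(q_λ − 1)·(T/I_nT) = 0` and `#G_ℓ·(T/I_nT) = 0` (Howard's standing at Kolyvagin primes).
BSD is not proved by any of this.

References: B. Howard, *The Heegner point Kolyvagin system*, Compositio Math. 140 (2004), Def. 1.1.8,
Prop. 1.1.7, Def. 1.2.1, Def. 1.2.3 (arXiv:1202.6340 pp. 5–7); B. Mazur, K. Rubin, *Kolyvagin systems*
(2004), Def. 1.2.2 / Lemma 1.2.1; C.-H. Kim, *The structure of Selmer groups…*, §2.2.2 (generator-fixed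
convention); J.-P. Serre, Invent. Math. 15 (1972) §1.3; *Local Fields* XIV §3.
-/

set_option autoImplicit false

noncomputable section

open Function Field ValuativeRel NumberField IsDedekindDomain
open scoped Classical TensorProduct NumberField

namespace Literature.NumberTheory.GaloisCohomology.Howard2004

open Literature.NumberTheory.GaloisRepresentations
open Literature.NumberTheory.GaloisRepresentations.DiscreteGaloisModule
open Literature.NumberTheory.GaloisRepresentations.IsNonarchimedeanLocalField
open Literature.NumberTheory.Automorphic

/-! ## §1 `a ↦ a ⊗ γ` is bijective for a finite cyclic `G = ⟨γ⟩` with `#G · A = 0` -/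

section TensorCyclic

variable {A : Type} [AddCommGroup A] {G : Type} [AddCommGroup G]

/-- `x • a` depends only on `x mod n` when `n • a = 0`. [folklore] -/
private theorem mod_nsmul_eq {n : ℕ} {a : A} (ha : n • a = 0) (x : ℕ) : (x % n) • a = x • a := by
  conv_rhs => rw [← Nat.mod_add_div x n, add_nsmul, mul_comm, ← smul_smul, ha, smul_zero, add_zero]

/-- **`a ↦ a ⊗ γ : A → A ⊗_ℤ G` is surjective** when `γ` generates `G`. [folklore] -/
private theorem tmulRight_surjective (γ : G) (hγ : ∀ x : G, x ∈ AddSubgroup.zmultiples γ) :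
    Function.Surjective fun a : A => a ⊗ₜ[ℤ] γ := by
  intro x
  induction x using TensorProduct.induction_on with
  | zero => exact ⟨0, by simp⟩
  | tmul a g =>
      obtain ⟨k, rfl⟩ := AddSubgroup.mem_zmultiples_iff.mp (hγ g)
      exact ⟨k • a, by rw [TensorProduct.tmul_smul, TensorProduct.smul_tmul']⟩
  | add x y hx hy =>
      obtain ⟨a, rfl⟩ := hx
      obtain ⟨b, rfl⟩ := hy
      exact ⟨a + b, by simp [TensorProduct.add_tmul]⟩

/-- A left inverse of `a ↦ a ⊗ γ` on `A ⊗_ℤ G`, `G = ⟨γ⟩` finite of order `n`, `n • A = 0`: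
`a ⊗ g ↦ (e g) • a` with `e : G ≃ ℤ/n`, `e γ = 1`. [folklore] -/
private theorem exists_leftInverse_tmulRight [Finite G] (γ : G)
    (hγ : ∀ x : G, x ∈ AddSubgroup.zmultiples γ) (hA : ∀ a : A, Nat.card G • a = 0) :
    ∃ L : A ⊗[ℤ] G →+ A, ∀ a : A, L (a ⊗ₜ γ) = a := by
  set n := Nat.card G with hn
  haveI : NeZero n := ⟨Nat.card_pos.ne'⟩
  let e : G ≃+ ZMod n := (zmodAddEquivOfGenerator hγ rfl).symm
  have he : e γ = 1 := zmodAddEquivOfGenerator_symm_apply_generator hγ rfl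
  -- the biadditive map `(a, g) ↦ (e g).val • a`
  let B : A →+ G →+ A :=
    { toFun := fun a =>
        { toFun := fun g => (e g).val • a
          map_zero' := by simp
          map_add' := fun g g' => by
            rw [map_add, ZMod.val_add, mod_nsmul_eq (hA a), add_nsmul] }
      map_zero' := by ext g; simp
      map_add' := fun a a' => by ext g; simp }
  refine ⟨TensorProduct.liftAddHom B fun r a g => ?_, fun a => ?_⟩
  · -- `ℤ`-balance is automatic for a biadditive map
    have h1 : B (r • a) g = r • B a g := by
      rw [← AddMonoidHom.flip_apply B (r • a) g, map_zsmul, AddMonoidHom.flip_apply]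
    have h2 : B a (r • g) = r • B a g := map_zsmul (B a) r g
    exact h1.trans h2.symm
  · rw [TensorProduct.liftAddHom_tmul]
    change (e γ).val • a = a
    rw [he]
    -- `(1 : ZMod n).val • a = a` (for `n = 1`, `a = 0`)
    rcases Nat.lt_or_ge 1 n with h | h
    · haveI : Fact (1 < n) := ⟨h⟩
      rw [ZMod.val_one, one_nsmul]
    · have hn1 : n = 1 := le_antisymm h (NeZero.one_le)
      have ha : a = 0 := by simpa [hn1] using hA a
      subst ha; simp

/-- **`a ↦ a ⊗ γ : A → A ⊗_ℤ G` is bijective** for `G` finite cyclic generated by `γ` and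
`#G · A = 0` — the algebra behind reading «`H¹_s ⊗ k_vˣ ≅ T`» (Prop. 1.1.7) as
«`H¹_s ⊗ G_ℓ ≅ T`» at a generator (Def. 1.2.3: the second factor is passed through `k_λˣ ↠ G_ℓ`).
[cite: Howard2004HeegnerKolyvagin, Def. 1.2.3 (arXiv p. 6, L126–131)] -/
theorem tmulRight_bijective [Finite G] (γ : G) (hγ : ∀ x : G, x ∈ AddSubgroup.zmultiples γ)
    (hA : ∀ a : A, Nat.card G • a = 0) : Function.Bijective fun a : A => a ⊗ₜ[ℤ] γ := by
  refine ⟨fun a b h => ?_, tmulRight_surjective γ hγ⟩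
  obtain ⟨L, hL⟩ := exists_leftInverse_tmulRight γ hγ hA
  have := congrArg L h
  rwa [hL, hL] at this

end TensorCyclic

/-! ## §2 Tame pins and the finite–singular comparison map -/

section Pin

variable {K : Type} [Field K] [NumberField K]

/-- `q_v = #k_v`: the residue field of the completion `K_v` is the residue field `𝓞_K/v`
(in the `residueFieldCard` form of the local files). [cite: NeukirchANT1999, Ch. II Prop. (4.3)] -/
theorem residueFieldCard_adicCompletion_eq_natCard (v : HeightOneSpectrum (𝓞 K)) :
    residueFieldCard (v.adicCompletion K) = Nat.card (𝓞 K ⧸ v.asIdeal) := by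
  rw [residueFieldCard_adicCompletion_eq, HeightOneSpectrum.residueCard_eq_card_quotient]

/-- **A tame pin at the finite place `v`**: the data fixing the generator-dependent reading of
Howard's finite–singular comparison map — a tame generator `σ₀ ∈ I_{K_v}` (the tame character of
level `q_v − 1` takes a primitive root of unity at `σ₀`: the element «`σ_α`»), an arithmetic
Frobenius lift `φ ∈ Γ_{K_v}` («evaluation at the Frobenius automorphism») and a generator `g` of
`k_vˣ` (the «`α`» with `G_ℓ = k_λˣ/k_ℓˣ` generated by its image).  Such data exist (`nonempty_tamePin`).
[cite: Howard2004HeegnerKolyvagin, Prop. 1.1.7 / Def. 1.1.8 / Def. 1.2.1 (arXiv pp. 5–6)]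
[cite: Kim2022StructureSelmer, §2.2.2 (generator-fixed convention)] -/
structure TamePin (v : HeightOneSpectrum (𝓞 K)) where
  /-- the tame generator `σ₀ ∈ I_{K_v}` -/
  gen : absInertia (v.adicCompletion K)
  isTameGenerator : IsTameGenerator gen
  /-- an arithmetic Frobenius lift `φ ∈ Γ_{K_v}` -/
  frob : absoluteGaloisGroup (v.adicCompletion K)
  isFrobPow : IsFrobPow frob 1
  /-- a generator `g` of `k_vˣ` -/
  unit : (𝓞 K ⧸ v.asIdeal)ˣ
  mem_zpowers_unit : ∀ u : (𝓞 K ⧸ v.asIdeal)ˣ, u ∈ Subgroup.zpowers unit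

/-- **Tame pins exist at every finite place.** [cite: SerreInventiones1972, §1.3 Prop. 2]
[cite: Howard2004HeegnerKolyvagin, Def. 1.2.1 (arXiv p. 6, L69–72: `G_ℓ` cyclic)] -/
theorem nonempty_tamePin (v : HeightOneSpectrum (𝓞 K)) : Nonempty (TamePin v) := by
  obtain ⟨σ₀, hσ₀⟩ := exists_isTameGenerator (F := v.adicCompletion K)
  obtain ⟨φ, hφ⟩ := exists_isAbsArithFrob_holds (F := v.adicCompletion K)
  haveI : Finite (𝓞 K ⧸ v.asIdeal) := v.asIdeal.finiteQuotientOfFreeOfNeBot v.ne_bot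
  letI : Field (𝓞 K ⧸ v.asIdeal) := Ideal.Quotient.field _
  obtain ⟨g, hg⟩ := IsCyclic.exists_generator (α := (𝓞 K ⧸ v.asIdeal)ˣ)
  exact ⟨⟨σ₀, hσ₀, φ, IsAbsArithFrob.isFrobPow_holds hφ, g, hg⟩⟩

namespace TamePin

variable {v : HeightOneSpectrum (𝓞 K)}

/-- The image `ḡ ∈ G_v = k_vˣ/k_ℓˣ` of the pinned generator. [cite: Howard2004HeegnerKolyvagin, Def. 1.2.1 (arXiv p. 6, L69–72)] -/
def gbar (π : TamePin v) : Gell v :=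
  QuotientAddGroup.mk (Additive.ofMul π.unit)

/-- `ḡ` generates `G_v`. [cite: Howard2004HeegnerKolyvagin, Def. 1.2.1 (arXiv p. 6, L69–72)] -/
theorem mem_zmultiples_gbar (π : TamePin v) (x : Gell v) : x ∈ AddSubgroup.zmultiples π.gbar := by
  obtain ⟨u, rfl⟩ := QuotientAddGroup.mk_surjective x
  obtain ⟨k, hk⟩ := Subgroup.mem_zpowers_iff.mp (π.mem_zpowers_unit (Additive.toMul u))
  refine AddSubgroup.mem_zmultiples_iff.mpr ⟨k, ?_⟩
  rw [gbar, ← QuotientAddGroup.mk_zsmul]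
  exact congrArg (fun w : (𝓞 K ⧸ v.asIdeal)ˣ => (QuotientAddGroup.mk (Additive.ofMul w) : Gell v)) hk

variable {N : Type} [AddCommGroup N] [TopologicalSpace N] [DiscreteTopology N]

/-- **The finite–singular comparison map with the tame pin `π`**:
`fs c = (singularEval σ₀)⁻¹ (c(φ)) ⊗ ḡ : H¹(K_v, N) → H¹_s(K_v, N) ⊗ G_v` — «`H¹_f ≅ T`» (evaluation at
`φ`), «`T ≅ H¹_s ⊗ k_vˣ`» (inverse of `c ⊗ g ↦ c(σ_g)` at the generator `g`), then `k_vˣ ↠ G_v`.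
Defined on all of `H¹(K_v, N)`; only its restriction to `H¹_f = H¹_ur` is Howard's map (there it does
not depend on the Frobenius lift, `FiniteSingularEvaluation.evalClass_eq_of_mem_unramified`).
Hypotheses: trivial local action, `N` finite, `(q_v − 1)·N = 0` (Def. 1.1.8: «`G_{K_v}` acts
trivially on `T`, and `|k_vˣ|·T = 0`»).
[cite: Howard2004HeegnerKolyvagin, Def. 1.1.8 and Def. 1.2.3 (arXiv Def. 2.1.8 p. 5 L144–149; p. 6 L126–131)]
[cite: MazurRubinMemoirs2004, Def. 1.2.2] -/
def fs (π : TamePin v) (ρ : DiscreteGaloisModule (v.adicCompletion K) N) [Finite N]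
    (htriv : ∀ (σ : absoluteGaloisGroup (v.adicCompletion K)) (x : N), ρ σ x = x)
    (hq : ∀ x : N, (residueFieldCard (v.adicCompletion K) - 1) • x = 0) :
    galoisCohomology ρ 1 →+ SingularQuotient ρ ⊗[ℤ] Gell v :=
  ((TensorProduct.mk ℤ (SingularQuotient ρ) (Gell v)).flip π.gbar).toAddMonoidHom.comp
    ((AddEquiv.ofBijective (singularEval ρ htriv π.gen)
        (singularEval_bijective ρ htriv π.isTameGenerator hq)).symm.toAddMonoidHom.comp
      (evalClass ρ htriv π.frob))

/-- Unfolding `fs`: `fs c = (singularEval σ₀)⁻¹ (c(φ)) ⊗ ḡ`. [cite: Howard2004HeegnerKolyvagin, Def. 1.1.8 (arXiv p. 5)] -/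
theorem fs_apply (π : TamePin v) (ρ : DiscreteGaloisModule (v.adicCompletion K) N) [Finite N]
    (htriv : ∀ (σ : absoluteGaloisGroup (v.adicCompletion K)) (x : N), ρ σ x = x)
    (hq : ∀ x : N, (residueFieldCard (v.adicCompletion K) - 1) • x = 0) (c : galoisCohomology ρ 1) :
    π.fs ρ htriv hq c =
      (AddEquiv.ofBijective (singularEval ρ htriv π.gen)
          (singularEval_bijective ρ htriv π.isTameGenerator hq)).symm (evalClass ρ htriv π.frob c)
        ⊗ₜ[ℤ] π.gbar :=
  rfl

/-- **The value of `fs` is pinned by evaluation**: if `z(σ₀) = c(φ)` for a class `c` and a cocycle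
`z`, then `fs c = loc^s[z] ⊗ ḡ` — i.e. `singularEval σ₀` of the first factor of `fs c` is `c(φ)`
(«`c ⊗ α ↦ c(σ_α)`» inverted at the generator).
[cite: Howard2004HeegnerKolyvagin, Prop. 1.1.7 / Def. 1.1.8 (arXiv p. 5, L129–149)] -/
theorem fs_eq_of_apply_eq (π : TamePin v) (ρ : DiscreteGaloisModule (v.adicCompletion K) N) [Finite N]
    (htriv : ∀ (σ : absoluteGaloisGroup (v.adicCompletion K)) (x : N), ρ σ x = x)
    (hq : ∀ x : N, (residueFieldCard (v.adicCompletion K) - 1) • x = 0) (c : galoisCohomology ρ 1)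
    (z : contOneCocycles ρ.toTopRep)
    (hz : z.1 (π.gen : absoluteGaloisGroup (v.adicCompletion K)) = evalClass ρ htriv π.frob c) :
    π.fs ρ htriv hq c = singularMap ρ (oneCocycleClass ρ.toTopRep z) ⊗ₜ[ℤ] π.gbar := by
  rw [fs_apply]
  congr 1
  rw [AddEquiv.symm_apply_eq, AddEquiv.ofBijective_apply, singularEval_singularMap_oneCocycleClass, hz]

/-- `singularEval σ₀` of the `H¹_s`-factor of `fs c` recovers `c(φ)`: with `fs c = x ⊗ ḡ`,
`singularEval σ₀ x = c(φ)`. [cite: Howard2004HeegnerKolyvagin, Prop. 1.1.7 / Def. 1.1.8 (arXiv p. 5)] -/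
theorem singularEval_fsFactor (π : TamePin v) (ρ : DiscreteGaloisModule (v.adicCompletion K) N) [Finite N]
    (htriv : ∀ (σ : absoluteGaloisGroup (v.adicCompletion K)) (x : N), ρ σ x = x)
    (hq : ∀ x : N, (residueFieldCard (v.adicCompletion K) - 1) • x = 0) (c : galoisCohomology ρ 1) :
    singularEval ρ htriv π.gen
        ((AddEquiv.ofBijective (singularEval ρ htriv π.gen)
          (singularEval_bijective ρ htriv π.isTameGenerator hq)).symm (evalClass ρ htriv π.frob c)) =
      evalClass ρ htriv π.frob c :=
  (AddEquiv.ofBijective (singularEval ρ htriv π.gen) _).apply_symm_apply _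

end TamePin

end Pin

/-! ## §3 Naturality in the module -/

section Natural

variable {K : Type} [Field K] [NumberField K] {v : HeightOneSpectrum (𝓞 K)}
  {N : Type} [AddCommGroup N] [TopologicalSpace N] [DiscreteTopology N]
  {N' : Type} [AddCommGroup N'] [TopologicalSpace N'] [DiscreteTopology N']

/-- Evaluation commutes with `H¹(g)`: `(H¹(g) c)(γ) = g (c(γ))`.
[cite: Howard2004HeegnerKolyvagin, Prop. 1.1.7 (arXiv p. 5, L137–138: functoriality of evaluation)] -/
theorem evalClass_localH1Map (ρ : DiscreteGaloisModule K N) (ρ' : DiscreteGaloisModule K N')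
    (v : HeightOneSpectrum (𝓞 K)) (g : N →+ N')
    (hg : ∀ (σ : absoluteGaloisGroup (v.adicCompletion K)) (x : N),
      g (GaloisRep.toLocal v ρ σ x) = GaloisRep.toLocal v ρ' σ (g x))
    (htriv : ∀ (σ : absoluteGaloisGroup (v.adicCompletion K)) (x : N), GaloisRep.toLocal v ρ σ x = x)
    (htriv' : ∀ (σ : absoluteGaloisGroup (v.adicCompletion K)) (x : N'), GaloisRep.toLocal v ρ' σ x = x)
    (γ : absoluteGaloisGroup (v.adicCompletion K)) (c : galoisCohomology (GaloisRep.toLocal v ρ) 1) :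
    evalClass (GaloisRep.toLocal v ρ') htriv' γ (localH1Map ρ ρ' v g hg c) =
      g (evalClass (GaloisRep.toLocal v ρ) htriv γ c) := by
  obtain ⟨z, rfl⟩ := oneCocycleClass_surjective (DiscreteGaloisModule.toTopRep (GaloisRep.toLocal v ρ)) c
  rw [localH1Map, galoisCohomology.map_one_oneCocycleClass, evalClass_oneCocycleClass,
    evalClass_oneCocycleClass, contOneCocycles.pullback_apply]
  rfl

/-- `singularEval σ₀` commutes with `H¹_s(g)`. [cite: Howard2004HeegnerKolyvagin, Prop. 1.1.7 (arXiv p. 5, L138–141)] -/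
theorem singularEval_singularQuotientMap (ρ : DiscreteGaloisModule K N) (ρ' : DiscreteGaloisModule K N')
    (v : HeightOneSpectrum (𝓞 K)) (g : N →+ N')
    (hg : ∀ (σ : absoluteGaloisGroup (v.adicCompletion K)) (x : N),
      g (GaloisRep.toLocal v ρ σ x) = GaloisRep.toLocal v ρ' σ (g x))
    (htriv : ∀ (σ : absoluteGaloisGroup (v.adicCompletion K)) (x : N), GaloisRep.toLocal v ρ σ x = x)
    (htriv' : ∀ (σ : absoluteGaloisGroup (v.adicCompletion K)) (x : N'), GaloisRep.toLocal v ρ' σ x = x)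
    (σ₀ : absInertia (v.adicCompletion K)) (x : SingularQuotient (GaloisRep.toLocal v ρ)) :
    singularEval (GaloisRep.toLocal v ρ') htriv' σ₀ (singularQuotientMap ρ ρ' v g hg x) =
      g (singularEval (GaloisRep.toLocal v ρ) htriv σ₀ x) := by
  obtain ⟨c, rfl⟩ := QuotientAddGroup.mk_surjective x
  exact evalClass_localH1Map ρ ρ' v g hg htriv htriv' σ₀ c

/-- **`fs` is natural in the module** (the shape of `LevelData.FsNaturalAt`): for global modules
`ρ, ρ'`, an additive `g : N → N'` equivariant for `Γ_{K_v}`, and ANY class `c ∈ H¹(K_v, N)`,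
`fs' (H¹(g) c) = (H¹_s(g) ⊗ 1) (fs c)` — both factors of `fs` are evaluations of cocycles, which
commute with `g` («evaluation at the Frobenius» and «`c ⊗ α ↦ c(σ_α)`» are functorial in `T`).
[cite: Howard2004HeegnerKolyvagin, Prop. 1.1.7 and Def. 1.1.8 (arXiv p. 5, L129–149)] -/
theorem TamePin.fs_natural (π : TamePin v) (ρ : DiscreteGaloisModule K N) (ρ' : DiscreteGaloisModule K N')
    [Finite N] [Finite N'] (g : N →+ N')
    (hg : ∀ (σ : absoluteGaloisGroup (v.adicCompletion K)) (x : N),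
      g (GaloisRep.toLocal v ρ σ x) = GaloisRep.toLocal v ρ' σ (g x))
    (htriv : ∀ (σ : absoluteGaloisGroup (v.adicCompletion K)) (x : N), GaloisRep.toLocal v ρ σ x = x)
    (htriv' : ∀ (σ : absoluteGaloisGroup (v.adicCompletion K)) (x : N'), GaloisRep.toLocal v ρ' σ x = x)
    (hq : ∀ x : N, (residueFieldCard (v.adicCompletion K) - 1) • x = 0)
    (hq' : ∀ x : N', (residueFieldCard (v.adicCompletion K) - 1) • x = 0)
    (c : galoisCohomology (GaloisRep.toLocal v ρ) 1) :
    π.fs (GaloisRep.toLocal v ρ') htriv' hq' (localH1Map ρ ρ' v g hg c) =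
      TensorProduct.map (singularQuotientMap ρ ρ' v g hg).toIntLinearMap LinearMap.id
        (π.fs (GaloisRep.toLocal v ρ) htriv hq c) := by
  rw [TamePin.fs_apply, TamePin.fs_apply, TensorProduct.map_tmul, LinearMap.id_apply,
    AddMonoidHom.coe_toIntLinearMap]
  congr 1
  -- both sides have the same `singularEval σ₀`, which is injective on `H¹_s(K_v, N')`
  apply singularEval_injective (GaloisRep.toLocal v ρ') htriv' π.isTameGenerator hq'
  rw [TamePin.singularEval_fsFactor π _ htriv' hq', singularEval_singularQuotientMap ρ ρ' v g hg htriv htriv',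
    TamePin.singularEval_fsFactor π _ htriv hq, evalClass_localH1Map ρ ρ' v g hg htriv htriv']

end Natural

/-! ## §4 Bijectivity on the unramified classes -/

section Bijective

variable {K : Type} [Field K] [NumberField K] {v : HeightOneSpectrum (𝓞 K)}
  {N : Type} [AddCommGroup N] [TopologicalSpace N] [DiscreteTopology N]

/-- **`fs` restricted to `H¹_f = H¹_ur(K_v, N)` is a bijection onto `H¹_s(K_v, N) ⊗ G_v`** (the shape
of `LevelData.FsBijectiveAt`), when moreover `#G_v · N = 0`: composite of «`H¹_f ≅ T`»
(`evalClass_bijective_unramified`), «`T ≅ H¹_s`» at the generator (`singularEval_bijective`) and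
`x ↦ x ⊗ ḡ` (`tmulRight_bijective`, `G_v = ⟨ḡ⟩` of order killing `H¹_s ≅ N`).
[cite: Howard2004HeegnerKolyvagin, Def. 1.1.8 («the isomorphism `φ^{fs}`») and Def. 1.2.3 (arXiv p. 5 L144–149, p. 6 L126–131)] -/
theorem TamePin.fs_bijective_unramified (π : TamePin v) (ρ : DiscreteGaloisModule (v.adicCompletion K) N)
    [Finite N] (htriv : ∀ (σ : absoluteGaloisGroup (v.adicCompletion K)) (x : N), ρ σ x = x)
    (hq : ∀ x : N, (residueFieldCard (v.adicCompletion K) - 1) • x = 0)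
    (hG : ∀ x : N, Nat.card (Gell v) • x = 0) :
    Function.Bijective fun c : unramifiedSubgroup ρ 1 => π.fs ρ htriv hq (c : galoisCohomology ρ 1) := by
  haveI : Finite (𝓞 K ⧸ v.asIdeal) := v.asIdeal.finiteQuotientOfFreeOfNeBot v.ne_bot
  haveI : Finite (Gell v) := by unfold Gell; infer_instance
  set E := AddEquiv.ofBijective (singularEval ρ htriv π.gen)
    (singularEval_bijective ρ htriv π.isTameGenerator hq) with hE
  have hGs : ∀ x : SingularQuotient ρ, Nat.card (Gell v) • x = 0 := fun x => by
    apply E.injective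
    rw [map_nsmul, map_zero, AddEquiv.ofBijective_apply, hG]
  have h3 := tmulRight_bijective (A := SingularQuotient ρ) π.gbar π.mem_zmultiples_gbar hGs
  have h : (fun c : unramifiedSubgroup ρ 1 => π.fs ρ htriv hq (c : galoisCohomology ρ 1)) =
      (fun x : SingularQuotient ρ => x ⊗ₜ[ℤ] π.gbar) ∘ E.symm ∘
        fun c : unramifiedSubgroup ρ 1 => evalClass ρ htriv π.frob (c : galoisCohomology ρ 1) := by
    funext c; rfl
  rw [h]
  exact h3.comp (E.symm.bijective.comp (evalClass_bijective_unramified ρ htriv π.isFrobPow))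

/-- **`#G_ℓ = ℓ + 1` at a degree-two prime** (`G_ℓ = k_λˣ/k_ℓˣ`, `#k_λ = ℓ²`): so `#G_ℓ · (T/I_nT) = 0`
follows from Howard's `ℓ + 1 ∈ I_ℓ ⊆ I_n`.
[cite: Howard2004HeegnerKolyvagin, Def. 1.2.1 (arXiv p. 6, L63–72)] -/
theorem natCard_gell_of_isDegreeTwo (hv : IsDegreeTwo v) : Nat.card (Gell v) = residueChar v + 1 := by
  haveI : Finite (𝓞 K ⧸ v.asIdeal) := v.asIdeal.finiteQuotientOfFreeOfNeBot v.ne_bot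
  letI : Field (𝓞 K ⧸ v.asIdeal) := Ideal.Quotient.field _
  have hℓ : (residueChar v).Prime := by
    unfold residueChar; exact CharP.char_is_prime (𝓞 K ⧸ v.asIdeal) _
  haveI : Fact (residueChar v).Prime := ⟨hℓ⟩
  -- `k_ℓˣ ↪ k_λˣ` is injective with image of order `ℓ - 1`
  have hinj : Function.Injective (primeFieldUnitsHom v) := by
    intro a b h
    apply Units.ext
    have h' := congrArg (fun u : (𝓞 K ⧸ v.asIdeal)ˣ => (u : 𝓞 K ⧸ v.asIdeal)) h
    exact (ZMod.castHom (dvd_refl (residueChar v)) (𝓞 K ⧸ v.asIdeal)).injective h'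
  have hrange : Nat.card (primeFieldUnitsHom v).range = residueChar v - 1 := by
    rw [Nat.card_congr (MonoidHom.ofInjective hinj).toEquiv.symm, Nat.card_units, Nat.card_zmod]
  have hunits : Nat.card (𝓞 K ⧸ v.asIdeal)ˣ = residueChar v ^ 2 - 1 := by
    rw [Nat.card_units, ← hv]
  -- Lagrange in `Additive k_λˣ`
  have hlag := (primeFieldUnitsHom v).range.toAddSubgroup.card_eq_card_quotient_mul_card_addSubgroup
  have h1 : Nat.card (Additive (𝓞 K ⧸ v.asIdeal)ˣ) = residueChar v ^ 2 - 1 := hunits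
  have h2 : Nat.card (primeFieldUnitsHom v).range.toAddSubgroup = residueChar v - 1 := hrange
  rw [h1, h2] at hlag
  change residueChar v ^ 2 - 1 = Nat.card (Gell v) * (residueChar v - 1) at hlag
  have hpos : 0 < residueChar v - 1 := Nat.sub_pos_of_lt hℓ.one_lt
  have hsq : residueChar v ^ 2 - 1 = (residueChar v + 1) * (residueChar v - 1) := by
    have h2le : 1 ≤ residueChar v := hℓ.one_lt.le
    zify [h2le, Nat.one_le_pow 2 _ hℓ.pos]
    ring
  rw [hsq] at hlag
  exact (Nat.eq_of_mul_eq_mul_right hpos hlag).symm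

end Bijective

/-! ## §5 The tame slot of a `LevelData` and its admissibility -/

section Slot

variable {K : Type} [Field K] [NumberField K] {M : Type} [AddCommGroup M] [TopologicalSpace M]
  [DiscreteTopology M] {R : Type} [CommRing R] [Module R M]
  {p : ℕ} {ρ : DiscreteGaloisModule K M} {t : SelmerTriple p ρ}
  {N : Finset (HeightOneSpectrum (𝓞 K)) → Type} [∀ n, AddCommGroup (N n)]
  [∀ n, TopologicalSpace (N n)] [∀ n, DiscreteTopology (N n)] [∀ n, Module R (N n)]

/-- The hypotheses under which the tame slot is Howard's map at `(n, v)`: trivial local action on the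
presentation of `T/I_nT` at `v` and `(q_v − 1)·(T/I_nT) = 0` («`G_{K_v}` acts trivially on `T`, and
`|k_vˣ|·T = 0`», Def. 1.1.8).
[cite: Howard2004HeegnerKolyvagin, Def. 1.1.8 (arXiv p. 5, L144–146)] -/
def TameHyp (ρq : ∀ n, DiscreteGaloisModule K (N n)) (n : Finset (HeightOneSpectrum (𝓞 K)))
    (v : HeightOneSpectrum (𝓞 K)) : Prop :=
  (∀ (σ : absoluteGaloisGroup (v.adicCompletion K)) (x : N n), GaloisRep.toLocal v (ρq n) σ x = x) ∧
    ∀ x : N n, (residueFieldCard (v.adicCompletion K) - 1) • x = 0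

/-- **The tame slot**: at `(n, v)` where `TameHyp` holds, Howard's finite–singular map with the pin
`π v`; elsewhere `0` (the slot is only evaluated at `λ ∈ n ∈ 𝓝(𝓛)`, where the hypotheses hold).
[cite: Howard2004HeegnerKolyvagin, Def. 1.1.8 / Def. 1.2.3 (arXiv p. 5 L144–149, p. 6 L126–131)] -/
def tameSlot [∀ n, Finite (N n)] (π : ∀ v : HeightOneSpectrum (𝓞 K), TamePin v)
    (ρq : ∀ n, DiscreteGaloisModule K (N n)) (n : Finset (HeightOneSpectrum (𝓞 K)))
    (v : HeightOneSpectrum (𝓞 K)) :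
    galoisCohomology (GaloisRep.toLocal v (ρq n)) 1 →+
      SingularQuotient (GaloisRep.toLocal v (ρq n)) ⊗[ℤ] Gell v :=
  if h : TameHyp ρq n v then (π v).fs (GaloisRep.toLocal v (ρq n)) h.1 h.2 else 0

/-- Unfolding the tame slot where the hypotheses hold. [cite: Howard2004HeegnerKolyvagin, Def. 1.1.8 (arXiv p. 5)] -/
theorem tameSlot_eq [∀ n, Finite (N n)] (π : ∀ v : HeightOneSpectrum (𝓞 K), TamePin v)
    (ρq : ∀ n, DiscreteGaloisModule K (N n)) {n : Finset (HeightOneSpectrum (𝓞 K))}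
    {v : HeightOneSpectrum (𝓞 K)} (h : TameHyp ρq n v) :
    tameSlot π ρq n v = (π v).fs (GaloisRep.toLocal v (ρq n)) h.1 h.2 := by
  rw [tameSlot, dif_pos h]

/-- **A `LevelData` with the tame slot is `IsFsAdmissible`** — the finite–singular slot pinned to
(the tame reading of) Howard's comparison map is bijective on the finite classes and natural in the
module at every `λ ∈ n ∈ 𝓝(𝓛)`, given there: trivial local action, `(q_λ − 1)·(T/I_nT) = 0`
and `#G_ℓ·(T/I_nT) = 0` (at `λ ∈ 𝓛₀`: `T` unramified, `Frob_λ ≡ 1 mod I_ℓ ⊆ I_n`, `ℓ + 1 ∈ I_ℓ`,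
`#k_λ = ℓ²`, `#G_ℓ = ℓ + 1`, `natCard_gell_of_isDegreeTwo`).  This inhabits the `fs_admissible`
field of `DVRSetting.SatisfiesH` / `CoeffTowerSetting.FsAdmissible`.
[cite: Howard2004HeegnerKolyvagin, Def. 1.1.8 and Def. 1.2.3 (arXiv p. 5 L144–149, p. 6 L126 – p. 7 L12)] -/
theorem LevelData.isFsAdmissible_of_fs_eq_tameSlot [Fact p.Prime] [∀ n, Finite (N n)]
    (D : LevelData R ρ t N) (π : ∀ v : HeightOneSpectrum (𝓞 K), TamePin v)
    (hfs : D.fs = tameSlot π D.ρq)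
    (hhyp : ∀ n ∈ t.levelSet, ∀ v ∈ n, TameHyp D.ρq n v)
    (hG : ∀ n ∈ t.levelSet, ∀ v ∈ n, ∀ x : N n, Nat.card (Gell v) • x = 0) :
    D.IsFsAdmissible := by
  intro n hn v hv
  refine ⟨?_, fun n' hn' hv' => ?_⟩
  · -- bijectivity on the unramified classes
    have h := hhyp n hn v hv
    change Function.Bijective fun x : unramifiedSubgroup (GaloisRep.toLocal v (D.ρq n)) 1 =>
      D.fs n v (x : galoisCohomology (GaloisRep.toLocal v (D.ρq n)) 1)
    rw [hfs]
    simp_rw [tameSlot_eq π D.ρq h]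
    exact (π v).fs_bijective_unramified (GaloisRep.toLocal v (D.ρq n)) h.1 h.2 (hG n hn v hv)
  · -- naturality
    have h := hhyp n hn v hv
    have h' := hhyp n' hn' v hv'
    intro g hg c _
    rw [hfs, tameSlot_eq π D.ρq h, tameSlot_eq π D.ρq h']
    exact (π v).fs_natural (D.ρq n) (D.ρq n') g.toAddMonoidHom hg h.1 h'.1 h.2 h'.2 c

end Slot

end Literature.NumberTheory.GaloisCohomology.Howard2004

end
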